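import Summits.BirchSwinnertonDyer.BirchSwinnertonDyer.Theorems.ResidualThetaTransportAtTwoSignedMuVanishingAtTwoPlusSel2
import Summits.BirchSwinnertonDyer.BirchSwinnertonDyer.Theorems.ResidualThetaTransportAtTwoSignedMuSeedAtTwoPlusSplitFiniteness
import Literature.NumberTheory.EllipticCurves.FineSelmerClassGroupCriterion
import Literature.NumberTheory.ComplexMultiplication.EllipticUnits.RubinEulerSystem
import HarnessLib

/-!
# Line `index-identity-descent` for crux `SignedMuSeedAtTwoPlus` (stmt-BirchSwinnertonDyer-21438) — crux-ideate r1 k2 (g10)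

PROPOSAL SKELETON (not registered — W-79: the line of record stays `Lines/sign_dichotomy.lean`).  Card:
`Ideas/index-identity-descent.md`; line card: `Lines/index_identity_descent.md`.

THE FINE HALF IS A SQUARE CLASS.  The crux allows `A := W` (door p580570); a seed must supply
«`Sel⁺(W/ℚ_∞)[2]` finite», which splits (p585569, p596845, Lim 2017 at two) into the class-group half
(F) «classical `μ₂ = 0` for the cyclotomic `ℤ₂`-extension of `ℚ(W[2])`» and the plus-local half (P⁺).
This line replaces every previous route to (F) — all of which contain an elliptic-unit EULER-SYSTEM step at
`p = 2` that is not in print — by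

* `OukhabaIndexAtTwo` (T1, IN PRINT for every prime: Oukhaba, Bull. SMF 135 (2007) 299, Théorème p. 300 and
  p. 301 «la ℤ_p-extension cyclotomique vérifie l'hypothèse de décomposition»; Tohoku 61 (2009) 253): along the
  cyclotomic `ℤ₂`-tower of a finite abelian `F ⊇ H(K)` over an imaginary quadratic `K`,
  `ord₂[ℰ(F_n) : 𝒞(F_n)] = ord₂ h(F_n) + c` for `n ≫ 0` — a Kronecker-limit-formula IDENTITY, no Euler system,
  no main conjecture, no Gras equality (the tree's `Rubin1991.thm13/thm33`, `Rubin1994.gras_*` all exclude `2`);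
* `RhoUnitIndexBoundedOnHabitat` (T6 ⟹ T4, with T3): on the habitat⁺, for `K = ℚ(√Δ_W)` (`2` inert) and
  `F = K(W[2])·H(K)`, the `ρ̄`-isotypic unit-index exponent `ord₂[ℰ(F_n):𝒞(F_n)] − ord₂[ℰ(H_n):𝒞(H_n)]` is
  `O(n)`.  By the card's T3/T4 (Iwasawa's Λ-freeness of universal-norm local units + Brumer) this FOLLOWS from
  the square-class statement LNS(ρ̄) «some norm-coherent ρ̄-elliptic unit `ζ_m` is not a root of unity times a
  square in `∏_{𝔓∣2} F_{m,𝔓}ˣ`», with the explicit bound `2^{m+1}·n + B`; and LNS(ρ̄) ⟺ (F)(ρ̄);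
* `FineHalf_of_rhoUnitIndexBounded` (T2 + T5): the identity for `F` and for `H` (`3 ∈ ℤ₂ˣ`), norm descent
  `F_n → ℚ(W[2])_n` and Iwasawa's growth formula turn the `O(n)` bound into `ClassicalMuVanishes`.

The (P⁺) half is NOT this line's business: `PlusHalfOnHabitat` below is the partner-free conclusion of
`theta_symbol_seed` stubs S1+S2+S4 (or of `sign_dichotomy`'s plus half) and is imported as such.
BSD is not proved by any of this; nothing here asserts the crux, (F), (P⁺) or LNS — every open statement is
a `sorry`-stub, and the only theorem concluding the crux is `SignedMuSeedAtTwoPlus_of`, from the stubs.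
-/

open scoped NumberField
open WeierstrassCurve Literature.NumberTheory.EllipticCurves
open Literature.NumberTheory.EllipticCurves.Kobayashi2003
open Literature.NumberTheory.EllipticCurves.Rank1Residual
open Literature.NumberTheory.IwasawaTheory
open Literature.NumberTheory.ComplexMultiplication.EllipticUnits
open Literature.NumberTheory.NumberFields (rayClassField)
open Summit.BirchSwinnertonDyer.BirchSwinnertonDyer.Theses.ResidualThetaTransportAtTwo

set_option autoImplicit false
set_option linter.dupNamespace false

noncomputable section

namespace Summit.BirchSwinnertonDyer.BirchSwinnertonDyer.Cruxes.SignedMuSeedAtTwoPlus.IndexIdentityDescent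

/-! ## Carriers (tree objects only) -/

section Layers
variable {K : Type} [Field K]

/-- The `n`-th layer `F_n = F(ζ_{2^{n+2}} + ζ_{2^{n+2}}⁻¹)` of the cyclotomic `ℤ₂`-tower of `F` inside `K̄`
(for `F ∩ ℚ(μ_{2^∞}) = ℚ`, e.g. `d_K ≡ 5 (mod 8)`, this is exactly the `n`-th layer). -/
def cycLayerTwo (F : IntermediateField K (AlgebraicClosure K)) (n : ℕ) :
    IntermediateField K (AlgebraicClosure K) :=
  F ⊔ IntermediateField.adjoin K
    {x : AlgebraicClosure K | ∃ ζ : AlgebraicClosure K, IsPrimitiveRoot ζ (2 ^ (n + 2)) ∧ x = ζ + ζ⁻¹}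

/-- `e_n(F) = ord₂ h(F_n)`. -/
def classNumberTwoExp (F : IntermediateField K (AlgebraicClosure K)) (n : ℕ) : ℕ :=
  padicValNat 2 (Nat.card (ClassGroup (𝓞 (cycLayerTwo F n))))

variable [NumberField K]

/-- `i_n(F) = ord₂ [ℰ(F_n) : 𝒞(F_n)]` — Rubin's elliptic units (tree `ellipticUnits ι F_n`) in the global units
(tree `globalUnitsOf F_n`). -/
def unitIndexTwoExp (ι : K →+* ℂ) (F : IntermediateField K (AlgebraicClosure K)) (n : ℕ) : ℕ :=
  padicValNat 2
    (((ellipticUnits ι (cycLayerTwo F n)).subgroupOf (globalUnitsOf (cycLayerTwo F n))).index)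

/-- `K(W[2]) ⊆ K̄` for a curve `W/ℚ` read over the number field `K` (tree `divisionField` of the base change);
for `K = ℚ(√Δ_W) ⊆ ℚ(W[2])` this is `M = ℚ(W[2])` itself, embedded in `K̄`. -/
def twoDivisionFieldOver (W : WeierstrassCurve ℚ) (K : Type) [Field K] [NumberField K] :
    IntermediateField K (AlgebraicClosure K) :=
  (W.map (algebraMap ℚ K)).divisionField 2

/-- `F = K(W[2]) · H(K)` — the abelian extension of `K` containing the Hilbert class field on which Oukhaba's
identity is applied (`H ⊆ F` is his standing hypothesis). -/
def twoDivisionHilbertCompositum (W : WeierstrassCurve ℚ) (K : Type) [Field K] [NumberField K] :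
    IntermediateField K (AlgebraicClosure K) :=
  twoDivisionFieldOver W K ⊔ rayClassField K (⊤ : Ideal (𝓞 K))

end Layers

/-! ## Stub statements (named `Prop`s) -/

/-- **T1 (IN PRINT, all primes; port size XL, named-fact size S): Oukhaba's index identity at `p = 2` along the
cyclotomic tower.**  For `K` imaginary quadratic, `F ⊇ H(K)` finite abelian over `K`: the elliptic units have
finite index in every large layer and `ord₂[ℰ(F_n):𝒞(F_n)] = ord₂ h(F_n) + c` for `n ≥ N`.
Oukhaba, Bull. SMF 135 (2007) 299–321, Théorème p. 300 (+ p. 301); II, Tohoku Math. J. 61 (2009) 253. -/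
def OukhabaIndexAtTwo : Prop :=
  ∀ (K : Type) [Field K] [NumberField K], IsImaginaryQuadratic K → ∀ (ι : K →+* ℂ)
    (F : IntermediateField K (AlgebraicClosure K)) [FiniteDimensional K F],
    IsAbelianGalois K F → rayClassField K (⊤ : Ideal (𝓞 K)) ≤ F →
    ∃ (c : ℤ) (N : ℕ), ∀ n, N ≤ n →
      ((ellipticUnits ι (cycLayerTwo F n)).subgroupOf (globalUnitsOf (cycLayerTwo F n))).index ≠ 0 ∧
      (unitIndexTwoExp ι F n : ℤ) = classNumberTwoExp F n + c

/-- **T6 ⟹ T4 (with T3) — the UNIT-SIDE statement on the habitat⁺ (research lives in T6 = LNS(ρ̄); T3/T4 are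
classical):** for `K ≅ ℚ(√Δ_W)` and `F = K(W[2])·H(K)`, the `ρ̄`-isotypic elliptic-unit index exponent
`i_n(F) − i_n(H)` is bounded above by a linear function of `n`.  (By the card: ⟸ LNS(ρ̄) at layer `m` with slope
`2^{m+1}`, via Brumer's `2`-adic Leopoldt injection, the Λ-freeness of universal-norm local units in the cyclotomic
tower of the `2`-adic field `ℚ(W[2])_𝔓 ∌ i`, and `#(Λ^d/Λζ ⊗ Λ/ω_n)_fin = 2^{2vn+O(1)}`.) -/
def RhoUnitIndexBoundedOnHabitat : Prop :=
  ∀ (W : WeierstrassCurve ℚ) [W.IsElliptic] [W.IsGloballyMinimal], ¬ W.HasCM → W.analyticRank = 0 →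
    GoodSS W 2 → W.frobeniusTrace 2 = 0 → W.Δ < 0 →
    ∀ (K : Type) [Field K] [NumberField K], IsImaginaryQuadratic K →
      (∃ s : K, s ^ 2 = algebraMap ℚ K W.Δ) → ∀ (ι : K →+* ℂ),
        ∃ (l : ℕ) (ν : ℤ) (n₀ : ℕ), ∀ n, n₀ ≤ n →
          (unitIndexTwoExp ι (twoDivisionHilbertCompositum W K) n : ℤ)
            - unitIndexTwoExp ι (rayClassField K (⊤ : Ideal (𝓞 K))) n ≤ l * n + ν

/-- The class-group half (F) on the habitat⁺ — VERBATIM the conclusion of `theta_symbol_seed` stub S3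
(`FineHalfOfPartnerFlat`) with the partner hypotheses dropped. -/
def FineHalfOnHabitat : Prop :=
  ∀ (W : WeierstrassCurve ℚ) [W.IsElliptic] [W.IsGloballyMinimal], ¬ W.HasCM → W.analyticRank = 0 →
    GoodSS W 2 → W.frobeniusTrace 2 = 0 → W.Δ < 0 →
    ∀ κM : ZpExtension (W.divisionField 2) 2, κM.IsCyclotomic → ClassicalMuVanishes κM

/-- **T2 + T5 (size M each, classical): the identity, twice, and the descent to `ℚ(W[2])`.**  From T1 for `F` and
for `H` (both contain `H`; `#Gal(F/H) = 3 ∈ ℤ₂ˣ`, `A(F_n)^{C₃} ≅ A(H_n)`, `ℰ(F_n)^{C₃} = ℰ(H_n)`,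
`e₁𝒞(F_n)⊗ℤ₂ = 𝒞(H_n)⊗ℤ₂` by the distribution relations): `ord₂ #A(F_n)^{(ρ)} = (i_n(F) − i_n(H)) + O(1)`;
norm `F_n → ℚ(W[2])_n` (cokernel killed by `[F : ℚ(W[2])] = h_K`), the `C₃`-invariant part handled by CubicMuExact
E1 / Ferrero–Washington for `K·ℚ_n`, Iwasawa's growth formula (`iwasawa1959_classNumberPExp_growth`) and the
identification of the layers of any cyclotomic `κM` with `ℚ(W[2])(ζ_{2^{n+2}}+ζ̄)` (`d_K ≡ 5 mod 8`). -/
def FineHalfOfRhoUnitIndexBounded : Prop :=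
  OukhabaIndexAtTwo → RhoUnitIndexBoundedOnHabitat → FineHalfOnHabitat

/-- The plus-local half (P⁺) on the habitat⁺ — VERBATIM the conclusion of `theta_symbol_seed` stub S4
(`PlusHalfOfPartnerFlat`) with the partner hypotheses dropped; IMPORTED (that line's S1+S2+S4, or
`sign_dichotomy`'s plus half), not this line's content. -/
def PlusHalfOnHabitat : Prop :=
  ∀ (W : WeierstrassCurve ℚ) [W.IsElliptic] [W.IsGloballyMinimal], ¬ W.HasCM → W.analyticRank = 0 →
    GoodSS W 2 → W.frobeniusTrace 2 = 0 → W.Δ < 0 →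
      ∀ κ : ZpExtension ℚ 2, κ.IsCyclotomic →
        ((QuotientAddGroup.mk' (W.fineSelmerInfty κ)) ''
          {x : W.subgroupH1 2 κ.kerSubgroup | x ∈ signedSelmerInfty W κ 1 ∧ 2 • x = 0}).Finite

/-- Lim 2017 Thm 3.5 with Lemma 3.2 at `p = 2` (tree named fact; VERBATIM `theta_symbol_seed` S5). -/
def LimAtTwo : Prop :=
  Lim2017.thm35_at_two_fineSelmerDual_moduleFinite_of_classicalMuVanishes_of_le_divisionField_four

/-- `ℚ(W[2]) ≤ ℚ(W[4])` with `2`-power index (VERBATIM `theta_symbol_seed` S6). -/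
def DivisionTowerTwoFour : Prop :=
  ∀ (W : WeierstrassCurve ℚ) [W.IsElliptic],
    W.divisionField 2 ≤ W.divisionField 4 ∧
      ∃ k : ℕ, Module.finrank ℚ (W.divisionField 4) = 2 ^ k * Module.finrank ℚ (W.divisionField 2)

/-! ## Stubs -/

theorem stub_oukhabaIndexAtTwo : OukhabaIndexAtTwo := by
  sorry

theorem stub_rhoUnitIndexBoundedOnHabitat : RhoUnitIndexBoundedOnHabitat := by
  sorry

theorem stub_fineHalfOfRhoUnitIndexBounded : FineHalfOfRhoUnitIndexBounded := by
  sorry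

theorem stub_plusHalfOnHabitat : PlusHalfOnHabitat := by
  sorry

theorem stub_limAtTwo : LimAtTwo := by
  sorry

theorem stub_divisionTowerTwoFour : DivisionTowerTwoFour := by
  sorry

/-! ## Glue (no sorry) -/

/-- Kernel-checked bookkeeping modulo T1: `μ = 0` in growth form is EQUIVALENT to eventual linearity of the
unit-index exponent (both directions — the identity transports growth rates). -/
theorem classNumber_linear_iff_unitIndex_linear (h : OukhabaIndexAtTwo)
    (K : Type) [Field K] [NumberField K] (hK : IsImaginaryQuadratic K) (ι : K →+* ℂ)
    (F : IntermediateField K (AlgebraicClosure K)) [FiniteDimensional K F]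
    (hab : IsAbelianGalois K F) (hH : rayClassField K (⊤ : Ideal (𝓞 K)) ≤ F) :
    (∃ (l : ℕ) (ν : ℤ) (n₀ : ℕ), ∀ n, n₀ ≤ n → (classNumberTwoExp F n : ℤ) = l * n + ν) ↔
      (∃ (l : ℕ) (ν : ℤ) (n₀ : ℕ), ∀ n, n₀ ≤ n → (unitIndexTwoExp ι F n : ℤ) = l * n + ν) := by
  obtain ⟨c, N, hN⟩ := h K hK ι F hab hH
  constructor
  · rintro ⟨l, ν, n₀, hl⟩
    refine ⟨l, ν + c, max n₀ N, fun n hn => ?_⟩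
    have h1 := hl n (le_trans (le_max_left _ _) hn)
    have h2 := (hN n (le_trans (le_max_right _ _) hn)).2
    rw [h2, h1]; ring
  · rintro ⟨l, ν, n₀, hl⟩
    refine ⟨l, ν - c, max n₀ N, fun n hn => ?_⟩
    have h1 := hl n (le_trans (le_max_left _ _) hn)
    have h2 := (hN n (le_trans (le_max_right _ _) hn)).2
    linarith

/-- Certificate direction modulo T1: a linear UPPER bound on the unit-index exponent bounds `ord₂ h(F_n)`. -/
theorem classNumberTwoExp_le_of_unitIndex_le (h : OukhabaIndexAtTwo)
    (K : Type) [Field K] [NumberField K] (hK : IsImaginaryQuadratic K) (ι : K →+* ℂ)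
    (F : IntermediateField K (AlgebraicClosure K)) [FiniteDimensional K F]
    (hab : IsAbelianGalois K F) (hH : rayClassField K (⊤ : Ideal (𝓞 K)) ≤ F)
    {l : ℕ} {ν : ℤ} {n₀ : ℕ} (hle : ∀ n, n₀ ≤ n → (unitIndexTwoExp ι F n : ℤ) ≤ l * n + ν) :
    ∃ (c : ℤ) (N : ℕ), ∀ n, N ≤ n → (classNumberTwoExp F n : ℤ) ≤ l * n + ν - c := by
  obtain ⟨c, N, hN⟩ := h K hK ι F hab hH
  refine ⟨c, max n₀ N, fun n hn => ?_⟩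
  have h1 := hle n (le_trans (le_max_left _ _) hn)
  have h2 := (hN n (le_trans (le_max_right _ _) hn)).2
  linarith

/-- GLUE (no sorry): the Sel2-door hypothesis with `A := W` from the stub STATEMENTS, through Lim 2017 at two with
`L := ℚ(W[2])` and the landed `FineSplit.splitFiniteness` (p596845) — exactly as in `theta_symbol_seed`, with its
S3 replaced by T1 + (T6 ⟹ T4) + (T2 + T5). -/
theorem sel2Seed_of_stubs (t1 : OukhabaIndexAtTwo) (tA : RhoUnitIndexBoundedOnHabitat)
    (tB : FineHalfOfRhoUnitIndexBounded) (h4 : PlusHalfOnHabitat) (h5 : LimAtTwo) (h6 : DivisionTowerTwoFour) :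
    ∀ (W : WeierstrassCurve ℚ) [W.IsElliptic] [W.IsGloballyMinimal], ¬ W.HasCM → W.analyticRank = 0 →
      GoodSS W 2 → W.frobeniusTrace 2 = 0 → W.Δ < 0 →
      ∀ (κ : ZpExtension ℚ 2) (γ : Field.absoluteGaloisGroup ℚ), κ.IsCyclotomic → κ.IsTopGenerator γ →
        {s : signedSelmerInfty W κ 1 | 2 • s = 0}.Finite := by
  intro W _ _ hCM hr hss ha hΔ κ γ hκ hγ
  obtain ⟨hle, hk⟩ := h6 W
  exact Theorems.SignedMuAtTwo.FineSplit.splitFiniteness W κ γ hκ hγ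
    (fun κ' hκ' ↦ h5 W (W.divisionField 2) hle hk (tB t1 tA W hCM hr hss ha hΔ) κ' hκ')
    (h4 W hCM hr hss ha hΔ κ hκ)

/-- **THE SKELETON THEOREM: the crux BY NAME; the only `sorry`s in its closure are the six `stub_*` theorems**
(Sel2 door p580570 with `A := W`, `e := AddEquiv.refl`). -/
theorem SignedMuSeedAtTwoPlus_of :
    Summit.BirchSwinnertonDyer.BirchSwinnertonDyer.Theses.ResidualThetaTransportAtTwo.SignedMuSeedAtTwoPlus := by
  refine Theorems.SignedMuAtTwo.signedMuSeedAtTwoPlus_of_sel2Seed ?_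
  intro W _ _ hCM hr hss ha hΔ
  exact ⟨W, ‹_›, ‹_›, hss, ha, ⟨AddEquiv.refl _, fun σ P ↦ rfl⟩, fun κ γ hκ hγ _ ↦
    sel2Seed_of_stubs stub_oukhabaIndexAtTwo stub_rhoUnitIndexBoundedOnHabitat
      stub_fineHalfOfRhoUnitIndexBounded stub_plusHalfOnHabitat stub_limAtTwo stub_divisionTowerTwoFour
      W hCM hr hss ha hΔ κ γ hκ hγ⟩

end Summit.BirchSwinnertonDyer.BirchSwinnertonDyer.Cruxes.SignedMuSeedAtTwoPlus.IndexIdentityDescent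

end
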